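import Literature.Topology.FourManifolds.GaussDiagrams
import Literature.Topology.FourManifolds.KnotOfClosedCurve
import HarnessLib

/-!
# The stereographic chart of `GaussDiagrams.lean` in explicit coordinates; knots from chart curves

Topic `Literature/Topology/FourManifolds`; first brick of the proof of the named fact
`Literature.Topology.FourManifolds.Knot.exists_hasGaussDiagram_of_isIsotopic` (`GaussDiagrams.lean`:
every knot is isotopic to a knot in regular position with respect to the fixed stereographic
projection; Reidemeister, *Knotentheorie* (1932), Kap. I §1; Cromwell, *Knots and Links* (2004),
Thm. 3.2.1). Everything here is proved; no named facts.

The realisation layer of `GaussDiagrams.lean` reads a knot `K : 𝕊¹ ↪ 𝕊³` through the two maps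
`planarProjection x = ((1 - x₃)⁻¹ x₀, (1 - x₃)⁻¹ x₁)` and `height x = (1 - x₃)⁻¹ x₂`, i.e. through
the stereographic projection from the north pole `(0, 0, 0, 1)` with values in `(ℝ × ℝ) × ℝ`. This
file makes that projection a usable chart:

* `stereoNorthCoords : ℝ⁴ → (ℝ × ℝ) × ℝ`, the formula above on all of `ℝ⁴` (so that on the sphere
  `stereoNorthCoords x = (planarProjection x, height x)` definitionally), smooth off the hyperplane
  `{x₃ = 1}`; `stereoNorthInvCoe : (ℝ × ℝ) × ℝ → ℝ⁴`, the inverse stereographic map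
  `(a, b, h) ↦ (2a, 2b, 2h, r² - 1)/(r² + 1)` (`r² = a² + b² + h²`), smooth, with values on the unit
  sphere and never the north pole, and `stereoNorthInv` its corestriction to `𝕊³` (smooth as a map of
  manifolds); the two identities `stereoNorthCoords ∘ stereoNorthInvCoe = id`,
  `stereoNorthInv (stereoNorthCoords x) = x` for `x ≠ northPole`, and the injectivity of the differential of
  `stereoNorthInvCoe` (chain rule on the first identity).
* `Knot.stereoCurve K θ = (K.planeCurve θ, K.heightCurve θ)`: for a knot missing the north pole it
  is a `C^∞`, `2π`-periodic, regular curve identifying exactly the period translates (the proofs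
  of `KnotFlatArc.lean` for the chart from the south pole, verbatim for the explicit chart).
* `knotOfStereoCurve`: conversely a `C^∞`, `2π`-periodic, regular curve `e : ℝ → (ℝ × ℝ) × ℝ`
  which is injective modulo the period defines a knot (`IsRegularClosedCurve.toKnot` of
  `stereoNorthInvCoe ∘ e`, `KnotOfClosedCurve.lean`) missing the north pole, whose plane curve and height
  function are the components of `e`.

## References

* K. Reidemeister, *Knotentheorie*, Ergebnisse der Math. 1, Springer (1932), Kap. I §1.
  [Reidemeister1932]
* P. R. Cromwell, *Knots and Links*, CUP (2004), §3.2, Thm. 3.2.1 (held: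
  `book:cromwell2004-knots-links`, PDF p. 46). [Cromwell2004]
* D. Rolfsen, *Knots and Links* (1976), §3.E (regular projections). [Rolfsen1976]

## Design notes

The chart is kept in the explicit coordinates of `GaussDiagrams.lean` (codomain `(ℝ × ℝ) × ℝ`)
rather than Mathlib's `stereographic'`, whose codomain is identified with `ℝ³` through an
unspecified orthonormal basis; only smoothness, the two inverse identities and the chain rule are
needed downstream, never membership in the atlas. No statement of another file is modified; no
`sorry`; `𝔼 n`, `𝕊 n` are local notation as in `Knots.lean`.
-/

open scoped Manifold ContDiff Topology
open Function Set

noncomputable section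

namespace Literature.Topology.FourManifolds

/-- Local notation: `𝔼 n` is the model Euclidean space `EuclideanSpace ℝ (Fin n)`. -/
local notation "𝔼 " n:arg => EuclideanSpace ℝ (Fin n)

/-- Local notation: `𝕊 n` is the unit sphere in `EuclideanSpace ℝ (Fin (n + 1))`. -/
local notation "𝕊 " n:arg => (Metric.sphere (0 : EuclideanSpace ℝ (Fin (n + 1))) 1)

attribute [local instance] fact_finrank_euclideanSpace_two fact_finrank_euclideanSpace_four

/-! ### The stereographic projection from the north pole in explicit coordinates -/

/-- The **stereographic coordinates** of `GaussDiagrams.lean` extended to all of `ℝ⁴`: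
`x ↦ (((1 - x₃)⁻¹ x₀, (1 - x₃)⁻¹ x₁), (1 - x₃)⁻¹ x₂)`; on the sphere its components are
`planarProjection` and `height` (`stereoNorthCoords_coe`). Junk on the hyperplane `x₃ = 1`
(`(1 - 1)⁻¹ = 0`). Rolfsen (1976), §3.E. [folklore] -/
def stereoNorthCoords (x : 𝔼 4) : (ℝ × ℝ) × ℝ :=
  (((1 - x 3)⁻¹ * x 0, (1 - x 3)⁻¹ * x 1), (1 - x 3)⁻¹ * x 2)

/-- On the sphere the stereographic coordinates are `(planarProjection, height)`. [folklore] -/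
@[simp]
theorem stereoNorthCoords_coe (x : 𝕊 3) : stereoNorthCoords (x : 𝔼 4) = (planarProjection x, height x) :=
  rfl

/-- The squared radius `a² + b² + h²` of a point `((a, b), h)` of the chart. [folklore] -/
def stereoNorthRadSq (y : (ℝ × ℝ) × ℝ) : ℝ :=
  y.1.1 ^ 2 + y.1.2 ^ 2 + y.2 ^ 2

/-- The squared radius is nonnegative. [folklore] -/
theorem stereoNorthRadSq_nonneg (y : (ℝ × ℝ) × ℝ) : 0 ≤ stereoNorthRadSq y := by
  unfold stereoNorthRadSq; positivity

/-- `r² + 1 > 0`. [folklore] -/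
theorem stereoNorthRadSq_add_one_pos (y : (ℝ × ℝ) × ℝ) : 0 < stereoNorthRadSq y + 1 := by
  have := stereoNorthRadSq_nonneg y; linarith

/-- The squared radius is a smooth function. [folklore] -/
theorem contDiff_stereoNorthRadSq : ContDiff ℝ ∞ stereoNorthRadSq := by
  unfold stereoNorthRadSq
  fun_prop

/-- The **inverse stereographic map** into `ℝ⁴`:
`((a, b), h) ↦ (2a, 2b, 2h, r² - 1) / (r² + 1)`, `r² = a² + b² + h²`. Rolfsen (1976), §3.E.
[folklore] -/
def stereoNorthInvCoe (y : (ℝ × ℝ) × ℝ) : 𝔼 4 :=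
  WithLp.toLp 2 ![2 * y.1.1 / (stereoNorthRadSq y + 1), 2 * y.1.2 / (stereoNorthRadSq y + 1),
    2 * y.2 / (stereoNorthRadSq y + 1), (stereoNorthRadSq y - 1) / (stereoNorthRadSq y + 1)]

/-- Coordinate `0` of the inverse stereographic map. [folklore] -/
@[simp] theorem stereoNorthInvCoe_apply_zero (y : (ℝ × ℝ) × ℝ) :
    stereoNorthInvCoe y 0 = 2 * y.1.1 / (stereoNorthRadSq y + 1) := rfl

/-- Coordinate `1` of the inverse stereographic map. [folklore] -/
@[simp] theorem stereoNorthInvCoe_apply_one (y : (ℝ × ℝ) × ℝ) :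
    stereoNorthInvCoe y 1 = 2 * y.1.2 / (stereoNorthRadSq y + 1) := rfl

/-- Coordinate `2` of the inverse stereographic map. [folklore] -/
@[simp] theorem stereoNorthInvCoe_apply_two (y : (ℝ × ℝ) × ℝ) :
    stereoNorthInvCoe y 2 = 2 * y.2 / (stereoNorthRadSq y + 1) := rfl

/-- Coordinate `3` of the inverse stereographic map. [folklore] -/
@[simp] theorem stereoNorthInvCoe_apply_three (y : (ℝ × ℝ) × ℝ) :
    stereoNorthInvCoe y 3 = (stereoNorthRadSq y - 1) / (stereoNorthRadSq y + 1) := rfl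

/-- The last coordinate of the inverse stereographic map is `< 1`. [folklore] -/
theorem stereoNorthInvCoe_apply_three_lt_one (y : (ℝ × ℝ) × ℝ) : stereoNorthInvCoe y 3 < 1 := by
  rw [stereoNorthInvCoe_apply_three, div_lt_one (stereoNorthRadSq_add_one_pos y)]
  linarith

/-- `1 - (stereoNorthInvCoe y)₃ = 2 / (r² + 1)`. [folklore] -/
theorem one_sub_stereoNorthInvCoe_apply_three (y : (ℝ × ℝ) × ℝ) :
    1 - stereoNorthInvCoe y 3 = 2 / (stereoNorthRadSq y + 1) := by
  rw [stereoNorthInvCoe_apply_three]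
  have h := stereoNorthRadSq_add_one_pos y
  field_simp
  ring

/-- The inverse stereographic map takes values on the unit sphere. [folklore] -/
theorem norm_stereoNorthInvCoe (y : (ℝ × ℝ) × ℝ) : ‖stereoNorthInvCoe y‖ = 1 := by
  have h := stereoNorthRadSq_add_one_pos y
  rw [EuclideanSpace.norm_eq, Real.sqrt_eq_one, Fin.sum_univ_four]
  simp only [Real.norm_eq_abs, sq_abs, stereoNorthInvCoe_apply_zero, stereoNorthInvCoe_apply_one,
    stereoNorthInvCoe_apply_two, stereoNorthInvCoe_apply_three]
  rw [div_pow, div_pow, div_pow, div_pow, ← add_div, ← add_div, ← add_div, div_eq_one_iff_eq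
    (by positivity)]
  unfold stereoNorthRadSq
  ring

/-- The inverse stereographic map is smooth. [folklore] -/
theorem contDiff_stereoNorthInvCoe : ContDiff ℝ ∞ stereoNorthInvCoe := by
  rw [contDiff_euclidean]
  have hne : ∀ y, stereoNorthRadSq y + 1 ≠ 0 := fun y ↦ (stereoNorthRadSq_add_one_pos y).ne'
  have hr : ContDiff ℝ ∞ fun y ↦ stereoNorthRadSq y + 1 := contDiff_stereoNorthRadSq.add contDiff_const
  intro i
  fin_cases i
  · show ContDiff ℝ ∞ fun y ↦ 2 * y.1.1 / (stereoNorthRadSq y + 1)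
    exact (contDiff_const.mul (contDiff_fst.comp contDiff_fst)).div hr hne
  · show ContDiff ℝ ∞ fun y ↦ 2 * y.1.2 / (stereoNorthRadSq y + 1)
    exact (contDiff_const.mul (contDiff_snd.comp contDiff_fst)).div hr hne
  · show ContDiff ℝ ∞ fun y ↦ 2 * y.2 / (stereoNorthRadSq y + 1)
    exact (contDiff_const.mul contDiff_snd).div hr hne
  · show ContDiff ℝ ∞ fun y ↦ (stereoNorthRadSq y - 1) / (stereoNorthRadSq y + 1)
    exact (contDiff_stereoNorthRadSq.sub contDiff_const).div hr hne

/-- The inverse stereographic map is differentiable. [folklore] -/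
theorem differentiable_stereoNorthInvCoe : Differentiable ℝ stereoNorthInvCoe :=
  contDiff_stereoNorthInvCoe.differentiable (by simp)

/-- **`stereoNorthCoords ∘ stereoNorthInvCoe = id`.** [folklore] -/
@[simp]
theorem stereoNorthCoords_stereoNorthInvCoe (y : (ℝ × ℝ) × ℝ) : stereoNorthCoords (stereoNorthInvCoe y) = y := by
  obtain ⟨⟨a, b⟩, c⟩ := y
  have h := stereoNorthRadSq_add_one_pos ((a, b), c)
  have h3 := one_sub_stereoNorthInvCoe_apply_three ((a, b), c)
  simp only [stereoNorthCoords, h3, stereoNorthInvCoe_apply_zero, stereoNorthInvCoe_apply_one,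
    stereoNorthInvCoe_apply_two, Prod.mk.injEq]
  refine ⟨⟨?_, ?_⟩, ?_⟩ <;> field_simp

/-- `stereoNorthInvCoe` is injective. [folklore] -/
theorem stereoNorthInvCoe_injective : Injective stereoNorthInvCoe := fun y y' h ↦ by
  rw [← stereoNorthCoords_stereoNorthInvCoe y, ← stereoNorthCoords_stereoNorthInvCoe y', h]

/-- The stereographic coordinates are smooth off the hyperplane `{x₃ = 1}`. [folklore] -/
theorem contDiffAt_stereoNorthCoords {x : 𝔼 4} (hx : x 3 ≠ 1) : ContDiffAt ℝ ∞ stereoNorthCoords x := by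
  have hc : ∀ i : Fin 4, ContDiff ℝ ∞ fun z : 𝔼 4 ↦ z i := fun i ↦
    (EuclideanSpace.proj i : 𝔼 4 →L[ℝ] ℝ).contDiff
  have hinv : ContDiffAt ℝ ∞ (fun z : 𝔼 4 ↦ (1 - z 3)⁻¹) x :=
    (contDiff_const.sub (hc 3)).contDiffAt.inv (sub_ne_zero.2 (Ne.symm hx))
  exact ((hinv.mul (hc 0).contDiffAt).prodMk (hinv.mul (hc 1).contDiffAt)).prodMk
    (hinv.mul (hc 2).contDiffAt)

/-- The stereographic coordinates are differentiable at the points of the image of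
`stereoNorthInvCoe`. [folklore] -/
theorem differentiableAt_stereoNorthCoords_stereoNorthInvCoe (y : (ℝ × ℝ) × ℝ) :
    DifferentiableAt ℝ stereoNorthCoords (stereoNorthInvCoe y) :=
  (contDiffAt_stereoNorthCoords (stereoNorthInvCoe_apply_three_lt_one y).ne).differentiableAt (by simp)

/-- **The differential of the inverse stereographic map is injective** (chain rule on
`stereoNorthCoords ∘ stereoNorthInvCoe = id`). [folklore] -/
theorem fderiv_stereoNorthInvCoe_injective (y : (ℝ × ℝ) × ℝ) :
    Injective (fderiv ℝ stereoNorthInvCoe y) := by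
  intro v w hvw
  have hcomp : fderiv ℝ (stereoNorthCoords ∘ stereoNorthInvCoe) y =
      (fderiv ℝ stereoNorthCoords (stereoNorthInvCoe y)).comp (fderiv ℝ stereoNorthInvCoe y) :=
    fderiv_comp y (differentiableAt_stereoNorthCoords_stereoNorthInvCoe y) (differentiable_stereoNorthInvCoe y)
  have hid : stereoNorthCoords ∘ stereoNorthInvCoe = id := funext stereoNorthCoords_stereoNorthInvCoe
  rw [hid, fderiv_id] at hcomp
  have hv := congrArg (fun L : ((ℝ × ℝ) × ℝ) →L[ℝ] ((ℝ × ℝ) × ℝ) ↦ L v) hcomp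
  have hw := congrArg (fun L : ((ℝ × ℝ) × ℝ) →L[ℝ] ((ℝ × ℝ) × ℝ) ↦ L w) hcomp
  simp only [ContinuousLinearMap.coe_id', id_eq, ContinuousLinearMap.coe_comp, comp_apply] at hv hw
  rw [hv, hw, hvw]

/-- The derivative of a curve through the inverse stereographic map vanishes only where the
derivative of the curve does. [folklore] -/
theorem deriv_stereoNorthInvCoe_comp_ne_zero {e : ℝ → (ℝ × ℝ) × ℝ} {θ : ℝ}
    (he : DifferentiableAt ℝ e θ) (hne : deriv e θ ≠ 0) : deriv (stereoNorthInvCoe ∘ e) θ ≠ 0 := by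
  rw [fderiv_comp_deriv θ (differentiable_stereoNorthInvCoe _) he]
  intro h0
  exact hne (fderiv_stereoNorthInvCoe_injective (e θ) (by rw [h0, map_zero]))

/-- **The inverse stereographic map** `(ℝ × ℝ) × ℝ → 𝕊³`. Rolfsen (1976), §3.E. [folklore] -/
def stereoNorthInv (y : (ℝ × ℝ) × ℝ) : 𝕊 3 :=
  ⟨stereoNorthInvCoe y, by rw [mem_sphere_zero_iff_norm, norm_stereoNorthInvCoe]⟩

/-- Coordinates of `stereoNorthInv`. [folklore] -/
@[simp] theorem coe_stereoNorthInv (y : (ℝ × ℝ) × ℝ) : (stereoNorthInv y : 𝔼 4) = stereoNorthInvCoe y := rfl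

/-- `stereoNorthInv` never reaches the north pole. [folklore] -/
theorem stereoNorthInv_ne_northPole (y : (ℝ × ℝ) × ℝ) : stereoNorthInv y ≠ northPole := by
  intro h
  have h3 := congrArg (fun z : 𝕊 3 ↦ (z : 𝔼 4) 3) h
  simp only [coe_stereoNorthInv, coe_northPole, PiLp.single_apply, if_true] at h3
  exact (stereoNorthInvCoe_apply_three_lt_one y).ne h3

/-- The planar projection of `stereoNorthInv y` is the first component of `y`. [folklore] -/
@[simp] theorem planarProjection_stereoNorthInv (y : (ℝ × ℝ) × ℝ) :
    planarProjection (stereoNorthInv y) = y.1 := by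
  have h := stereoNorthCoords_stereoNorthInvCoe y
  rw [← coe_stereoNorthInv, stereoNorthCoords_coe] at h
  exact congrArg Prod.fst h

/-- The height of `stereoNorthInv y` is the second component of `y`. [folklore] -/
@[simp] theorem height_stereoNorthInv (y : (ℝ × ℝ) × ℝ) : height (stereoNorthInv y) = y.2 := by
  have h := stereoNorthCoords_stereoNorthInvCoe y
  rw [← coe_stereoNorthInv, stereoNorthCoords_coe] at h
  exact congrArg Prod.snd h

/-- `stereoNorthInv` is smooth as a map into the manifold `𝕊³`. [folklore] -/
theorem contMDiff_stereoNorthInv : ContMDiff 𝓘(ℝ, (ℝ × ℝ) × ℝ) (𝓡 3) ∞ stereoNorthInv :=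
  contDiff_stereoNorthInvCoe.contMDiff.codRestrict_sphere fun y ↦ (stereoNorthInv y).2

/-- `stereoNorthInv` is continuous. [folklore] -/
@[continuity, fun_prop]
theorem continuous_stereoNorthInv : Continuous stereoNorthInv := contMDiff_stereoNorthInv.continuous

/-- A point of `𝕊³` other than the north pole has last coordinate `≠ 1`. [folklore] -/
theorem apply_three_ne_one_of_ne_northPole {x : 𝕊 3} (hx : x ≠ northPole) : (x : 𝔼 4) 3 ≠ 1 := by
  intro h3
  apply hx
  have hn := norm_eq_of_mem_sphere x
  rw [EuclideanSpace.norm_eq, Real.sqrt_eq_one, Fin.sum_univ_four] at hn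
  simp only [Real.norm_eq_abs, sq_abs, h3, one_pow] at hn
  have h0 : (x : 𝔼 4) 0 = 0 := by nlinarith [sq_nonneg ((x : 𝔼 4) 1), sq_nonneg ((x : 𝔼 4) 2)]
  have h1 : (x : 𝔼 4) 1 = 0 := by nlinarith [sq_nonneg ((x : 𝔼 4) 0), sq_nonneg ((x : 𝔼 4) 2)]
  have h2 : (x : 𝔼 4) 2 = 0 := by nlinarith [sq_nonneg ((x : 𝔼 4) 0), sq_nonneg ((x : 𝔼 4) 1)]
  apply Subtype.ext
  ext i
  fin_cases i <;> simp [h0, h1, h2, h3]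

/-- **`stereoNorthInv ∘ stereoNorthCoords = id` off the north pole.** [folklore] -/
theorem stereoNorthInv_stereoNorthCoords {x : 𝕊 3} (hx : x ≠ northPole) :
    stereoNorthInv (stereoNorthCoords (x : 𝔼 4)) = x := by
  have h3 := apply_three_ne_one_of_ne_northPole hx
  have h3' : (1 : ℝ) - (x : 𝔼 4) 3 ≠ 0 := sub_ne_zero.2 (Ne.symm h3)
  have hn := norm_eq_of_mem_sphere x
  rw [EuclideanSpace.norm_eq, Real.sqrt_eq_one, Fin.sum_univ_four] at hn
  simp only [Real.norm_eq_abs, sq_abs] at hn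
  -- the squared radius of the chart point
  have hr : stereoNorthRadSq (stereoNorthCoords (x : 𝔼 4)) = (1 + (x : 𝔼 4) 3) / (1 - (x : 𝔼 4) 3) := by
    simp only [stereoNorthRadSq, stereoNorthCoords]
    field_simp
    nlinarith [hn]
  have hr1 : stereoNorthRadSq (stereoNorthCoords (x : 𝔼 4)) + 1 = 2 / (1 - (x : 𝔼 4) 3) := by
    rw [hr]; field_simp; ring
  apply Subtype.ext
  ext i
  fin_cases i
  · simp only [coe_stereoNorthInv, Fin.zero_eta, stereoNorthInvCoe_apply_zero, hr1]
    simp only [stereoNorthCoords]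
    field_simp
  · simp only [coe_stereoNorthInv, Fin.mk_one, stereoNorthInvCoe_apply_one, hr1]
    simp only [stereoNorthCoords]
    field_simp
  · simp only [coe_stereoNorthInv, Fin.reduceFinMk, stereoNorthInvCoe_apply_two, hr1]
    simp only [stereoNorthCoords]
    field_simp
  · simp only [coe_stereoNorthInv, Fin.reduceFinMk, stereoNorthInvCoe_apply_three, hr]
    field_simp
    ring

/-- `stereoNorthInv` is surjective onto the complement of the north pole. [folklore] -/
theorem exists_stereoNorthInv_eq {x : 𝕊 3} (hx : x ≠ northPole) : ∃ y, stereoNorthInv y = x :=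
  ⟨_, stereoNorthInv_stereoNorthCoords hx⟩

/-! ### The chart curve of a knot missing the north pole -/

namespace Knot

variable (K : Knot)

/-- The **chart curve** of a knot: `θ ↦ (planeCurve K θ, heightCurve K θ)`, the knot read in the
stereographic chart from the north pole as a `2π`-periodic curve in `(ℝ × ℝ) × ℝ`.
Rolfsen (1976), §3.E. [folklore] -/
def stereoCurve (θ : ℝ) : (ℝ × ℝ) × ℝ :=
  (K.planeCurve θ, K.heightCurve θ)

/-- The chart curve is `stereoNorthCoords` of the curve of the knot in `ℝ⁴`. [folklore] -/
theorem stereoCurve_apply (θ : ℝ) : K.stereoCurve θ = stereoNorthCoords (SphereEmbedding.curve K θ) :=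
  rfl

/-- The chart curve as a composite. [folklore] -/
theorem stereoCurve_eq_comp : K.stereoCurve = stereoNorthCoords ∘ SphereEmbedding.curve K := rfl

/-- The first component of the chart curve is the plane curve. [folklore] -/
@[simp] theorem stereoCurve_fst (θ : ℝ) : (K.stereoCurve θ).1 = K.planeCurve θ := rfl

/-- The second component of the chart curve is the height function. [folklore] -/
@[simp] theorem stereoCurve_snd (θ : ℝ) : (K.stereoCurve θ).2 = K.heightCurve θ := rfl

/-- The plane curve is the first component of the chart curve. [folklore] -/
theorem planeCurve_eq_fst_comp : K.planeCurve = Prod.fst ∘ K.stereoCurve := rfl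

/-- The height function is the second component of the chart curve. [folklore] -/
theorem heightCurve_eq_snd_comp : K.heightCurve = Prod.snd ∘ K.stereoCurve := rfl

/-- The chart curve is `2π`-periodic. [folklore] -/
theorem periodic_stereoCurve : Periodic K.stereoCurve (2 * Real.pi) := fun θ ↦ by
  simp only [stereoCurve, K.periodic_planeCurve θ, K.periodic_heightCurve θ]

variable {K}

/-- Back through the chart: `stereoNorthInv (stereoCurve θ) = K (circlePoint θ)` for a knot missing the
north pole. [folklore] -/
theorem stereoNorthInv_stereoCurve (hK : ∀ x, K x ≠ northPole) (θ : ℝ) :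
    stereoNorthInv (K.stereoCurve θ) = K (circlePoint θ) :=
  stereoNorthInv_stereoNorthCoords (hK _)

/-- In `ℝ⁴`: `stereoNorthInvCoe (stereoCurve θ) = K.curve θ`. [folklore] -/
theorem stereoNorthInvCoe_stereoCurve (hK : ∀ x, K x ≠ northPole) (θ : ℝ) :
    stereoNorthInvCoe (K.stereoCurve θ) = SphereEmbedding.curve K θ := by
  rw [← coe_stereoNorthInv, stereoNorthInv_stereoCurve hK, SphereEmbedding.curve_apply]

/-- The curve of the knot in `ℝ⁴` factors through the chart curve. [folklore] -/
theorem curve_eq_stereoNorthInvCoe_comp (hK : ∀ x, K x ≠ northPole) :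
    SphereEmbedding.curve K = stereoNorthInvCoe ∘ K.stereoCurve :=
  funext fun θ ↦ (stereoNorthInvCoe_stereoCurve hK θ).symm

/-- Points of a knot missing the north pole have last coordinate `≠ 1` along the curve. [folklore] -/
theorem curve_apply_three_ne_one (hK : ∀ x, K x ≠ northPole) (θ : ℝ) :
    SphereEmbedding.curve K θ 3 ≠ 1 :=
  apply_three_ne_one_of_ne_northPole (hK _)

/-- **The chart curve of a knot missing the north pole is `C^∞`.** [folklore] -/
theorem contDiff_stereoCurve (hK : ∀ x, K x ≠ northPole) : ContDiff ℝ ∞ K.stereoCurve := by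
  rw [stereoCurve_eq_comp]
  rw [contDiff_iff_contDiffAt]
  intro θ
  exact (contDiffAt_stereoNorthCoords (curve_apply_three_ne_one hK θ)).comp θ
    (SphereEmbedding.contDiff_curve K).contDiffAt

/-- The chart curve is differentiable. [folklore] -/
theorem differentiable_stereoCurve (hK : ∀ x, K x ≠ northPole) : Differentiable ℝ K.stereoCurve :=
  (contDiff_stereoCurve hK).differentiable (by simp)

/-- The chart curve is continuous. [folklore] -/
theorem continuous_stereoCurve (hK : ∀ x, K x ≠ northPole) : Continuous K.stereoCurve :=
  (contDiff_stereoCurve hK).continuous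

/-- The plane curve of a knot missing the north pole is `C^∞`. [folklore] -/
theorem contDiff_planeCurve (hK : ∀ x, K x ≠ northPole) : ContDiff ℝ ∞ K.planeCurve :=
  contDiff_fst.comp (contDiff_stereoCurve hK)

/-- The height function of a knot missing the north pole is `C^∞`. [folklore] -/
theorem contDiff_heightCurve (hK : ∀ x, K x ≠ northPole) : ContDiff ℝ ∞ K.heightCurve :=
  contDiff_snd.comp (contDiff_stereoCurve hK)

/-- **The chart curve is regular.** [folklore] -/
theorem deriv_stereoCurve_ne_zero (hK : ∀ x, K x ≠ northPole) (θ : ℝ) :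
    deriv K.stereoCurve θ ≠ 0 := by
  intro h0
  have h1 : deriv (SphereEmbedding.curve K) θ =
      fderiv ℝ stereoNorthInvCoe (K.stereoCurve θ) (deriv K.stereoCurve θ) := by
    rw [curve_eq_stereoNorthInvCoe_comp hK]
    exact fderiv_comp_deriv θ (differentiable_stereoNorthInvCoe _) (differentiable_stereoCurve hK θ)
  rw [h0, map_zero] at h1
  exact SphereEmbedding.tangent_ne_zero K θ h1

/-- **The chart curve identifies exactly the period translates.** [folklore] -/
theorem stereoCurve_eq_iff (hK : ∀ x, K x ≠ northPole) {s t : ℝ} :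
    K.stereoCurve s = K.stereoCurve t ↔ circlePoint s = circlePoint t := by
  constructor
  · intro h
    have h1 : K (circlePoint s) = K (circlePoint t) := by
      rw [← stereoNorthInv_stereoCurve hK s, ← stereoNorthInv_stereoCurve hK t, h]
    exact K.injective h1
  · intro h
    exact Periodic.eq_of_circlePoint_eq K.periodic_stereoCurve h

/-- The derivative of the plane curve is the first component of the derivative of the chart
curve. [folklore] -/
theorem deriv_planeCurve_eq (hK : ∀ x, K x ≠ northPole) (θ : ℝ) :
    deriv K.planeCurve θ = (deriv K.stereoCurve θ).1 := by
  rw [planeCurve_eq_fst_comp]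
  exact ((ContinuousLinearMap.fst ℝ (ℝ × ℝ) ℝ).hasFDerivAt.comp_hasDerivAt θ
    (differentiable_stereoCurve hK θ).hasDerivAt).deriv

/-- The derivative of the height function is the second component of the derivative of the chart
curve. [folklore] -/
theorem deriv_heightCurve_eq (hK : ∀ x, K x ≠ northPole) (θ : ℝ) :
    deriv K.heightCurve θ = (deriv K.stereoCurve θ).2 := by
  rw [heightCurve_eq_snd_comp]
  exact ((ContinuousLinearMap.snd ℝ (ℝ × ℝ) ℝ).hasFDerivAt.comp_hasDerivAt θ
    (differentiable_stereoCurve hK θ).hasDerivAt).deriv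

end Knot

/-! ### Knots from chart curves -/

section OfCurve

variable {e : ℝ → (ℝ × ℝ) × ℝ}

/-- A `C^∞`, `2π`-periodic, regular chart curve gives a regular closed curve on `𝕊³` through the
inverse stereographic map. [folklore] -/
theorem isRegularClosedCurve_stereoNorthInvCoe_comp (he : ContDiff ℝ ∞ e)
    (hper : Periodic e (2 * Real.pi)) (hreg : ∀ θ, deriv e θ ≠ 0) :
    IsRegularClosedCurve (stereoNorthInvCoe ∘ e) where
  contDiff := contDiff_stereoNorthInvCoe.comp he
  periodic θ := by simp only [comp_apply, hper θ]
  norm_eq_one θ := norm_stereoNorthInvCoe _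
  deriv_ne_zero θ := deriv_stereoNorthInvCoe_comp_ne_zero (he.differentiable (by simp) θ) (hreg θ)

/-- Injectivity modulo the period passes to the curve on the sphere. [folklore] -/
theorem stereoNorthInvCoe_comp_eq_imp (hinj : ∀ s t, e s = e t → circlePoint s = circlePoint t)
    (s t : ℝ) (h : (stereoNorthInvCoe ∘ e) s = (stereoNorthInvCoe ∘ e) t) : circlePoint s = circlePoint t :=
  hinj s t (stereoNorthInvCoe_injective h)

/-- **The knot of a chart curve**: a `C^∞`, `2π`-periodic, regular curve `e : ℝ → (ℝ × ℝ) × ℝ`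
which is injective modulo `2π` defines the knot `θ ↦ stereoNorthInv (e θ)`
(`IsRegularClosedCurve.toKnot`, `KnotOfClosedCurve.lean`). Crowell–Fox, Ch. I §2 (differentiable
knots). [folklore] -/
def knotOfStereoCurve (he : ContDiff ℝ ∞ e) (hper : Periodic e (2 * Real.pi))
    (hreg : ∀ θ, deriv e θ ≠ 0) (hinj : ∀ s t, e s = e t → circlePoint s = circlePoint t) : Knot :=
  (isRegularClosedCurve_stereoNorthInvCoe_comp he hper hreg).toKnot (stereoNorthInvCoe_comp_eq_imp hinj)

variable (he : ContDiff ℝ ∞ e) (hper : Periodic e (2 * Real.pi)) (hreg : ∀ θ, deriv e θ ≠ 0)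
  (hinj : ∀ s t, e s = e t → circlePoint s = circlePoint t)

/-- The knot of a chart curve passes through `stereoNorthInv (e θ)` at `(cos θ, sin θ)`. [folklore] -/
@[simp]
theorem knotOfStereoCurve_apply_circlePoint (θ : ℝ) :
    knotOfStereoCurve he hper hreg hinj (circlePoint θ) = stereoNorthInv (e θ) := by
  apply Subtype.ext
  rw [knotOfStereoCurve, IsRegularClosedCurve.coe_toKnot_circlePoint]
  rfl

/-- The knot of a chart curve misses the north pole. [folklore] -/
theorem knotOfStereoCurve_ne_northPole (x : 𝕊 1) :
    knotOfStereoCurve he hper hreg hinj x ≠ northPole := by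
  obtain ⟨θ, rfl⟩ := circlePoint_surjective x
  rw [knotOfStereoCurve_apply_circlePoint]
  exact stereoNorthInv_ne_northPole _

/-- **The chart curve of the knot of `e` is `e`.** [folklore] -/
@[simp]
theorem stereoCurve_knotOfStereoCurve : (knotOfStereoCurve he hper hreg hinj).stereoCurve = e := by
  funext θ
  rw [Knot.stereoCurve_apply, SphereEmbedding.curve_apply, knotOfStereoCurve_apply_circlePoint,
    coe_stereoNorthInv, stereoNorthCoords_stereoNorthInvCoe]

/-- The plane curve of the knot of `e` is the first component of `e`. [folklore] -/
@[simp]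
theorem planeCurve_knotOfStereoCurve :
    (knotOfStereoCurve he hper hreg hinj).planeCurve = Prod.fst ∘ e := by
  rw [Knot.planeCurve_eq_fst_comp, stereoCurve_knotOfStereoCurve]

/-- The height function of the knot of `e` is the second component of `e`. [folklore] -/
@[simp]
theorem heightCurve_knotOfStereoCurve :
    (knotOfStereoCurve he hper hreg hinj).heightCurve = Prod.snd ∘ e := by
  rw [Knot.heightCurve_eq_snd_comp, stereoCurve_knotOfStereoCurve]

end OfCurve

end Literature.Topology.FourManifolds
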